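import Literature.AlgebraicGeometry.Frobenioids.Thm42SubII
import Literature.AlgebraicGeometry.Frobenioids.PrimesEquivFrobeniusType
import HarnessLib

/-!
# [FrdI] Theorem 4.2 (ii), sub-DAG row T42-L09 — discharge

Mochizuki, *The geometry of Frobenioids I: the general theory*, Kyushu J. Math. **62** (2008)
293–400, §4, Theorem 4.2 (ii), proof p. 80 ll. 34–43 [cite: MochizukiFrdI2008, Thm. 4.2 (ii) p.80].
PROOF-ONLY companion of `Thm42SubII.lean` (statements, seat abc-iut-L1-t14): the named row
`FrdI.T42.PsiPrimeFunctorialFrobeniusType` (functoriality of `Ψ^Prime(−)` with respect to morphisms of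
Frobenius type) holds, by `PreFrobenioid.primesEquiv_naturality_frobeniusType_mem`
(`PrimesEquivFrobeniusType.lean`, seat abc-iut-L1-t2: the square of Prop. 1.10 (i) with primary-pre-step
rows and Frobenius-type columns).  Of the setting only "`C₁`, `C₂` are Frobenioids" and "`Ψ` preserves
morphisms of Frobenius type" (Thm. 3.4 (iii)) are used.  No new definitions.
-/

namespace Literature.AlgebraicGeometry.Frobenioids

open CategoryTheory Opposite

namespace FrdI.T42

/-- **Row T42-L09 DISCHARGED** (p. 80 ll. 34–43; Prop. 1.10 (i)): `Ψ^Prime(−)` is compatible with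
`Prime(Φ₁(−))`, `Prime(Φ₂(−))` along morphisms of Frobenius type — `PrimesEquivFrobeniusType.lean`
(seat abc-iut-L1-t2). [cite: MochizukiFrdI2008, Thm. 4.2 (ii) p.80] -/
theorem PsiPrimeFunctorialFrobeniusType_holds : PsiPrimeFunctorialFrobeniusType := by
  intro D₁ _ Φ₁ C₁ _ D₂ _ Φ₂ C₂ _ F₁ F₂ Ψ hS hprim e he A A' γ hγ 𝔭 𝔭' h
  exact PreFrobenioid.primesEquiv_naturality_frobeniusType_mem Ψ.functor hS.isFrobenioid₁
    hS.isFrobenioid₂ hS.frobeniusType_map (fun E ε hε => hprim ε hε) (fun E ε hε => hprim ε hε)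
    (e A') (e A) (fun E ε hε 𝔮 h𝔮 => he A' ε hε 𝔮 h𝔮 _) (fun E ε hε 𝔮 h𝔮 => he A ε hε 𝔮 h𝔮 _)
    γ hγ 𝔭' 𝔭 h

end FrdI.T42

end Literature.AlgebraicGeometry.Frobenioids
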